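import Summits.AnomalousDissipation.AnomalousDissipation.Theorems.DopplerClockDopplerWorkIdentity
import Summits.AnomalousDissipation.AnomalousDissipation.Theorems.DopplerClockQuadratureStressFloorPeriodicDriftBookkeeping

/-!
# Route DopplerClock (AnomalousDissipation) — crux `QuadratureStressFloor`
# (stmt-AnomalousDissipation-18129), line `laminar-burst-shadowing`:
# the registered stub `stub_periodWorkIdentity`

Sorry-free discharge of the stub `stub_periodWorkIdentity` of the line `laminar-burst-shadowing`
(payload slug `Sketch`) for the crux
`Summit.AnomalousDissipation.AnomalousDissipation.Theses.DopplerClock.QuadratureStressFloor`: the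
PERIOD FORM of the route's landed two-mode rotation identity (`dopplerWorkIdentity_proof`, item
stmt-AnomalousDissipation-18133).

For the swept Doppler pair `f = F sin(2πm x₁) cos(2πn x₂) e₀` (`F > 0`), the quadrature streak
pattern `Ψ_s = sin(2πm x₁) sin(2πn x₂) e₀`, a drift `V > 0`, `ν > 0`, `n ≥ 1`, and a `τ`-periodic
(`τ > 0`) global classical solution `(u, p)` of `NS_ν` on `ℝ × 𝕋³` forced by `f` with momentum
`∫ u(0) = V e₂`:

`τ⁻¹ ∫₀^τ (−T_s(w(t))) dt = (V·2πn / F) · τ⁻¹ ν ∫₀^τ ‖∇u(t)‖₂² dt − νκ² · τ⁻¹ ∫₀^τ (Ψ_s, u(t)) dt`,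

`κ² = 4π²(m² + n²)`, `w = u − V e₂`, `T_s(w) = ∫ ⟪w, (w·∇)Ψ_s⟫`.

**Proof.** Fix a generalized (Banach) limit `Λ` (`GeneralizedLimit.nonempty_holds`). Periodic
bookkeeping (`stub_periodicDriftBookkeeping`, landed): `u` is a global Leray–Hopf solution from
`u 0` with a sup-in-time energy bound, so the landed identity applies and reads
`Λ⟨(f, u)⟩ = F / (V·2πn) · (νκ² Λ⟨(Ψ_s, u)⟩ − Λ⟨T_s(w)⟩)`. All three observables are `τ`-periodic
in time because `u` is, so each `Λ`-mean is the period mean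
(`GeneralizedLimit.longTimeAvg_eq_of_periodic`; Doering–Foias 2002, §2; Cheskidov 2023, §6), and
the period work identity `∫₀^τ (f, u) = ν ∫₀^τ ‖∇u‖₂²`
(`PeriodicDriftBookkeeping.intervalIntegral_inner_eq_of_periodic`, the energy equality over one
period, Robinson–Rodrigo–Sadowski 2016, Thm. 6.5) turns the injection mean into the dissipation
mean. Solving the resulting linear relation for `−τ⁻¹ ∫₀^τ T_s` (`F ≠ 0`, `V·2πn ≠ 0`) is
`periodWorkIdentity_algebra`.

No new definitions; the registered stub is the last theorem, verbatim signature.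

References: C. R. Doering, C. Foias, *Energy dissipation in body-forced turbulence*, J. Fluid
Mech. 467 (2002), §2; A. Cheskidov, *Dissipation anomaly and anomalous dissipation in
incompressible fluid flows*, arXiv:2311.04182 (2023), §6; J. C. Robinson, J. L. Rodrigo,
W. Sadowski, *The Three-Dimensional Navier–Stokes Equations*, CUP 2016, Thm. 6.5.
-/

noncomputable section

-- `Summit.<Summit>.<Problem>` is the tree's mandated summit-side namespace (CONVENTIONS §2); for this
-- single-conjunct summit the two coincide, so the duplicate is deliberate.
set_option linter.dupNamespace false

open MeasureTheory Set Filter Topology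
open scoped InnerProductSpace RealInnerProductSpace

namespace Summit.AnomalousDissipation.AnomalousDissipation.Theorems

open Literature.Analysis.FluidPDE Literature.Analysis.FluidPDE.Torus
open Literature.Analysis.FunctionSpaces Literature.Analysis.FunctionSpaces.Torus

/-- **Linear algebra of the period work identity.** If `ΛA = F / c · (κ ΛB − ΛT)` with `F ≠ 0`,
`c ≠ 0`, and `ΛA = A`, `ΛB = B`, `ΛT = T`, then `−T = c / F · A − κ B`. [folklore] -/
theorem periodWorkIdentity_algebra {F c κ ΛA ΛB ΛT A B T : ℝ} (hF : F ≠ 0) (hc : c ≠ 0)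
    (hid : ΛA = F / c * (κ * ΛB - ΛT)) (hA : ΛA = A) (hB : ΛB = B) (hT : ΛT = T) :
    -T = c / F * A - κ * B := by
  subst hA hB hT
  have h1 : c / F * (F / c) = 1 := by
    rw [div_mul_div_comm, mul_comm c F, div_self (mul_ne_zero hF hc)]
  rw [hid]
  linear_combination (ΛT - κ * ΛB) * h1

/-- **Registered stub `stub_periodWorkIdentity`** of the line `laminar-burst-shadowing` (crux
`DopplerClock.QuadratureStressFloor`, stmt-AnomalousDissipation-18129): the PERIOD FORM of the
two-mode rotation identity (item stmt-AnomalousDissipation-18133). For `F, V, ν, τ > 0`, `n ≥ 1`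
and a `τ`-periodic global classical solution `(u, p)` of `NS_ν` on `ℝ × 𝕋³` forced by
`f = F sin(2πm x₁) cos(2πn x₂) e₀` with momentum `∫ u(0) = V e₂`,
`τ⁻¹ ∫₀^τ (−T_s(w)) = (V·2πn / F) · τ⁻¹ ν ∫₀^τ ‖∇u‖₂² − νκ² · τ⁻¹ ∫₀^τ (Ψ_s, u)`
(`w = u − V e₂`, `Ψ_s = sin(2πm x₁) sin(2πn x₂) e₀`, `κ² = 4π²(m² + n²)`): the landed `Λ`-form
(`dopplerWorkIdentity_proof`) on the Leray–Hopf data of `stub_periodicDriftBookkeeping`, every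
`Λ`-mean of a `τ`-periodic observable being its period mean
(`GeneralizedLimit.longTimeAvg_eq_of_periodic`; Doering–Foias 2002, §2; Cheskidov 2023, §6), and
the period work identity `∫₀^τ (f, u) = ν ∫₀^τ ‖∇u‖₂²` (Robinson–Rodrigo–Sadowski 2016, Thm. 6.5).
[folklore] -/
theorem stub_periodWorkIdentity :
    ∀ (F V ν τ : ℝ) (m n : ℕ) (u : ℝ → UnitAddTorus (Fin 3) → EuclideanSpace ℝ (Fin 3))
      (p : ℝ → UnitAddTorus (Fin 3) → ℝ), 0 < F → 0 < V → 0 < ν → 0 < n → 0 < τ →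
      Literature.Analysis.FunctionSpaces.Torus.IsClassicalNSSolutionOn Set.univ ν (fun _ => (fun (x : UnitAddTorus (Fin 3)) => (F * (UnitAddTorus.mFourier (Pi.single (1 : Fin 3) (m : ℤ)) x).im * (UnitAddTorus.mFourier (Pi.single (2 : Fin 3) (n : ℤ)) x).re) • EuclideanSpace.single (0 : Fin 3) (1 : ℝ))) u p →
      Function.Periodic u τ → (∫ x, u 0 x = V • EuclideanSpace.single (2 : Fin 3) (1 : ℝ)) →
      τ⁻¹ * ∫ t in (0 : ℝ)..τ,
          -(∫ x, inner ℝ (u t x - V • EuclideanSpace.single (2 : Fin 3) (1 : ℝ))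
            (Literature.Analysis.FunctionSpaces.Torus.convect (fun y => u t y - V • EuclideanSpace.single (2 : Fin 3) (1 : ℝ)) (fun (y : UnitAddTorus (Fin 3)) => ((UnitAddTorus.mFourier (Pi.single (1 : Fin 3) (m : ℤ)) y).im * (UnitAddTorus.mFourier (Pi.single (2 : Fin 3) (n : ℤ)) y).im) • EuclideanSpace.single (0 : Fin 3) (1 : ℝ)) x))
        = V * (2 * Real.pi * n) / F *
            (τ⁻¹ * (ν * ∫ t in (0 : ℝ)..τ, Literature.Analysis.FunctionSpaces.Torus.gradNormSq (u t))) -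
          ν * ((2 * Real.pi) ^ 2 * ((m : ℝ) ^ 2 + (n : ℝ) ^ 2)) *
            (τ⁻¹ * ∫ t in (0 : ℝ)..τ, ∫ x, inner ℝ ((fun (y : UnitAddTorus (Fin 3)) => ((UnitAddTorus.mFourier (Pi.single (1 : Fin 3) (m : ℤ)) y).im * (UnitAddTorus.mFourier (Pi.single (2 : Fin 3) (n : ℤ)) y).im) • EuclideanSpace.single (0 : Fin 3) (1 : ℝ)) x) (u t x)) := by
  intro F V ν τ m n u p hF hV hν hn hτ hsol hper hmom
  obtain ⟨Λ⟩ := GeneralizedLimit.nonempty_holds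
  obtain ⟨hLH, hE, -, -⟩ := stub_periodicDriftBookkeeping ν τ _ u p hν hτ hsol hper
  have hid := dopplerWorkIdentity_proof Λ F V ν m n (u 0) u hV hν hn hLH hmom hE
  have hn' : (0 : ℝ) < (n : ℝ) := Nat.cast_pos.2 hn
  have hc : V * (2 * Real.pi * (n : ℝ)) ≠ 0 := by positivity
  rw [intervalIntegral.integral_neg, mul_neg]
  refine periodWorkIdentity_algebra hF.ne' hc hid ?_ ?_ ?_
  · -- injection: `Λ⟨(f, u)⟩ = τ⁻¹ ∫₀^τ (f, u) = τ⁻¹ ν ∫₀^τ ‖∇u‖₂²`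
    rw [← PeriodicDriftBookkeeping.intervalIntegral_inner_eq_of_periodic hsol hper hτ.le]
    exact Λ.longTimeAvg_eq_of_periodic (fun t => by simp only [hper t]) hτ
  · -- quadrature pairing `Λ⟨(Ψ_s, u)⟩`
    exact Λ.longTimeAvg_eq_of_periodic (fun t => by simp only [hper t]) hτ
  · -- quadrature stress extraction `Λ⟨T_s(w)⟩`
    exact Λ.longTimeAvg_eq_of_periodic (fun t => by simp only [hper t]) hτ

end Summit.AnomalousDissipation.AnomalousDissipation.Theorems

end
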